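import Literature.Geometry.Lorentzian.KerrPhotonOrbit
import HarnessLib

/-!
# `CaptureSufficesTame` (stmt-FinalStateConjecture-17270), line `only-the-third-law-is-generic` (v5), brick K
# `stub_noC0_kerrSide`: Kerr–Schild kinematics and the lensing witness (explicit algebra)

The explicit Kerr–Schild algebra consumed by the model-point limit argument NoC0KerrChart (no C⁰-honest late
chart of a Kerr exterior into Minkowski space):

* (K1) `kerr_spatial_sub_time_le_bilin`, `kerr_spatialNorm_sq_le_time_sq` — since `g_{M,a} = η + 2H ℓ ⊗ ℓ`
  with `H ≥ 0` (`Kerr.scalarH_nonneg`), `η(v, v) ≤ g(v, v)`, so `g(v, v) ≤ 0` forces `|v⃗|² ≤ (v⁰)²`: the Kerr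
  cone sits inside the coordinate Minkowski cone;
* (K2) `kerr_norm_le_two_mul_abs_time` — the same with an operator-norm perturbation of size `1/4`:
  `‖v‖ ≤ 2 |v⁰|`;
* (K3) `kerr_time_strictMonoOn_and_norm_sub_le` — along a differentiable curve whose velocity is causal for a
  `1/4`-perturbed Kerr cone field and future (`v⁰ > 0`), `t* = x⁰` is strictly increasing and the Euclidean
  displacement is at most twice the `t*`-lapse (fencing theorem
  `image_norm_le_of_norm_deriv_right_le_deriv_boundary'`);
* (W1) `kerr_bilin_basisVector_zero_le` — `∂_{t*}` is timelike with margin `1/3` wherever `r ≥ 3M`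
  (`2H ≤ 2M/r ≤ 2/3`);
* (W2) `kerr_orbitCurve_add_period` — the photon orbit `Kerr.orbitCurve` returns to the same spatial point
  after parameter `2π/q`, shifted by `(1 − aq)(2π/q)` in `t*`;
* (W3) `kerr_orbitCurve_isGeodesic_null` — the orbit is a null geodesic of `Kerr.smoothMetric M a r₊` in the
  exterior with velocity `Kerr.orbitVel`: the content of the tree's `Kerr.exists_trappedNullGeodesic`
  (`KerrPhotonOrbit.lean`) with the curve exposed instead of hidden behind `∃` (same proof:
  `OpensChart.isGeodesic_of_hasDerivAt` with `Kerr.christoffel_orbitVel`, `Kerr.bilin_orbitVel_self`);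
* `stub_noC0_kerrSide` — the six conjuncts assembled: the registered text of the stub, by name.

## References

* R. P. Kerr, A. Schild, Proc. Symp. Appl. Math. 17 (1965) 199 (key `KerrSchild1965`).
* M. Visser, *The Kerr spacetime: a brief introduction*, arXiv:0706.0622, (32)–(35) (key `arXiv07060622`).
* J. Sbierski, Anal. PDE 8 (2015) 1379–1420, §7A (key `Sbierski2015`).
-/

-- the doubled `FinalStateConjecture.FinalStateConjecture` path component trips dupNamespace (as in the skeleton)
set_option linter.dupNamespace false

noncomputable section

open scoped Manifold ContDiff Topology
open Set Filter

namespace Summit.FinalStateConjecture.FinalStateConjecture.Theorems.PhaseMixingCaptureCaptureSufficesTame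

open Literature.Geometry.Lorentzian

/-! ## (K1)–(K2) The Kerr–Schild cone sits inside the coordinate Minkowski cone -/

/-- `η(v, v) = |v⃗|² − (v⁰)²` (O'Neill 1983, Ch. 3, p. 55). [folklore] -/
theorem minkowski_bilin_self_eq_spatial_sub_time (v : E4) :
    Minkowski.bilin v v = E4.spatialNorm v ^ 2 - (v 0) ^ 2 := by
  rw [Minkowski.bilin_apply, E4.spatialNorm_sq, Fin.sum_univ_three]
  simp only [Fin.succ_zero_eq_one, Fin.succ_one_eq_two, Fin.reduceSucc]
  ring

/-- `|v⃗|² − (v⁰)² = η(v, v) ≤ g_{M,a}(x)(v, v)` for `0 ≤ M`: `g = η + 2H ℓ ⊗ ℓ` with `H ≥ 0` (Visser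
arXiv:0706.0622, (32)–(33); the cone comparison `J⁺_g ⊆ J⁺_η` of the chart). [cite: arXiv07060622, (32)–(35)] -/
theorem kerr_spatial_sub_time_le_bilin {M : ℝ} (hM : 0 ≤ M) (a : ℝ) (x v : E4) :
    E4.spatialNorm v ^ 2 - (v 0) ^ 2 ≤ Kerr.bilin M a x v v := by
  rw [← minkowski_bilin_self_eq_spatial_sub_time, Kerr.bilin_apply]
  have hH := Kerr.scalarH_nonneg hM a x
  nlinarith [mul_self_nonneg (Kerr.nullCovector a x v)]

/-- **(K1)** The Kerr–Schild cone is narrower than the Minkowski cone of the chart: for `0 ≤ M`,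
`g_{M,a}(x)(v, v) ≤ 0` forces `|v⃗|² ≤ (v⁰)²`. Visser arXiv:0706.0622, (32)–(35) (`H ≥ 0`).
[cite: arXiv07060622, (32)–(35)] -/
theorem kerr_spatialNorm_sq_le_time_sq (M a : ℝ) (x v : E4) (hM : 0 ≤ M)
    (hv : Kerr.bilin M a x v v ≤ 0) : E4.spatialNorm v ^ 2 ≤ (v 0) ^ 2 := by
  linarith [kerr_spatial_sub_time_le_bilin hM a x v]

/-- **(K2)** The same with room: for a bilinear form `B` with `‖B − g_{M,a}(x)‖ ≤ 1/4`, `B(v, v) ≤ 0` forces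
`‖v‖ ≤ 2 |v⁰|` (`|v⃗|² − (v⁰)² ≤ g(v,v) ≤ ‖v‖²/4`). Visser arXiv:0706.0622, (32)–(35).
[cite: arXiv07060622, (32)–(35)] -/
theorem kerr_norm_le_two_mul_abs_time (M a : ℝ) (x v : E4) (B : E4 →L[ℝ] E4 →L[ℝ] ℝ) (hM : 0 ≤ M)
    (hB : ‖B - Kerr.bilin M a x‖ ≤ 1 / 4) (hv : B v v ≤ 0) : ‖v‖ ≤ 2 * |v 0| := by
  have h1 : ‖(B - Kerr.bilin M a x) v v‖ ≤ ‖B - Kerr.bilin M a x‖ * ‖v‖ * ‖v‖ :=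
    (B - Kerr.bilin M a x).le_opNorm₂ v v
  rw [Real.norm_eq_abs, sub_apply, sub_apply] at h1
  have h2 : |B v v - Kerr.bilin M a x v v| ≤ 1 / 4 * ‖v‖ * ‖v‖ := by
    refine h1.trans ?_
    gcongr
  have h3 := (abs_le.1 h2).1
  have h4 := kerr_spatial_sub_time_le_bilin hM a x v
  have h5 : ‖v‖ ^ 2 = (v 0) ^ 2 + E4.spatialNorm v ^ 2 := by
    rw [EuclideanSpace.real_norm_sq_eq, E4.spatialNorm_sq, Fin.sum_univ_four]
    ring
  have h6 : ‖v‖ ^ 2 ≤ (2 * |v 0|) ^ 2 := by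
    rw [mul_pow, sq_abs]
    nlinarith
  exact (sq_le_sq₀ (norm_nonneg v) (by positivity)).1 h6

/-! ## (K3) `t*` is a uniform time function with bounded speed along perturbed-causal curves -/

/-- The time coordinate of a differentiable curve of the chart has derivative the time component of the
velocity. [folklore] -/
theorem hasDerivAt_timeCoord {γ : ℝ → E4} {v : E4} {t : ℝ} (h : HasDerivAt γ v t) :
    HasDerivAt (fun t ↦ γ t 0) (v 0) t :=
  ((EuclideanSpace.proj (0 : Fin 4) : E4 →L[ℝ] ℝ).hasFDerivAt.comp_hasDerivAt t h)

/-- **(K3)** Along a curve `γ` differentiable on `[s₁, s₂]` whose velocity `v` is causal for a bilinear form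
`B_t` with `‖B_t − g_{M,a}(γ t)‖ ≤ 1/4` and future (`v⁰ > 0`), the time coordinate `t ↦ (γ t)⁰` is strictly
increasing on `[s₁, s₂]` and `‖γ s₂ − γ s₁‖ ≤ 2 ((γ s₂)⁰ − (γ s₁)⁰)` (by (K2), `‖v‖ ≤ 2 v⁰`, and the fencing
theorem). Visser arXiv:0706.0622, (32)–(35). [cite: arXiv07060622, (32)–(35)] -/
theorem kerr_time_strictMonoOn_and_norm_sub_le (M a : ℝ) (B : ℝ → E4 →L[ℝ] E4 →L[ℝ] ℝ) (γ : ℝ → E4)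
    (s₁ s₂ : ℝ) (hM : 0 ≤ M) (hs : s₁ ≤ s₂)
    (h : ∀ t ∈ Set.Icc s₁ s₂, ‖B t - Kerr.bilin M a (γ t)‖ ≤ 1 / 4 ∧
      ∃ v : E4, HasDerivAt γ v t ∧ B t v v ≤ 0 ∧ 0 < v 0) :
    StrictMonoOn (fun t ↦ γ t 0) (Set.Icc s₁ s₂) ∧ ‖γ s₂ - γ s₁‖ ≤ 2 * (γ s₂ 0 - γ s₁ 0) := by
  have h' : ∀ t ∈ Icc s₁ s₂, ∃ v : E4, HasDerivAt γ v t ∧ 0 < v 0 ∧ ‖v‖ ≤ 2 * v 0 := by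
    intro t ht
    obtain ⟨hB, v, hv, hBv, hv0⟩ := h t ht
    refine ⟨v, hv, hv0, ?_⟩
    have := kerr_norm_le_two_mul_abs_time M a (γ t) v (B t) hM hB hBv
    rwa [abs_of_pos hv0] at this
  choose! V hV hV0 hVn using h'
  have hderiv : ∀ t ∈ Icc s₁ s₂, HasDerivAt (fun t ↦ γ t 0) (V t 0) t := fun t ht ↦
    hasDerivAt_timeCoord (hV t ht)
  have hcont : ContinuousOn (fun t ↦ γ t 0) (Icc s₁ s₂) := fun t ht ↦
    (hderiv t ht).continuousAt.continuousWithinAt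
  have hmono : StrictMonoOn (fun t ↦ γ t 0) (Icc s₁ s₂) := by
    refine strictMonoOn_of_deriv_pos (convex_Icc s₁ s₂) hcont fun t ht ↦ ?_
    rw [interior_Icc] at ht
    rw [(hderiv t (Ioo_subset_Icc_self ht)).deriv]
    exact hV0 t (Ioo_subset_Icc_self ht)
  refine ⟨hmono, ?_⟩
  have hγc : ContinuousOn γ (Icc s₁ s₂) := fun t ht ↦ (hV t ht).continuousAt.continuousWithinAt
  have key := image_norm_le_of_norm_deriv_right_le_deriv_boundary' (f := fun t ↦ γ t - γ s₁) (f' := V)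
    (a := s₁) (b := s₂) (hγc.sub continuousOn_const)
    (fun t ht ↦ ((hV t (Ico_subset_Icc_self ht)).sub_const (γ s₁)).hasDerivWithinAt)
    (B := fun t ↦ 2 * (γ t 0 - γ s₁ 0)) (B' := fun t ↦ 2 * V t 0) (by simp)
    (continuousOn_const.mul (hcont.sub continuousOn_const))
    (fun t ht ↦ (((hderiv t (Ico_subset_Icc_self ht)).sub_const (γ s₁ 0)).const_mul 2).hasDerivWithinAt)
    (fun t ht ↦ hVn t (Ico_subset_Icc_self ht)) (right_mem_Icc.2 hs)
  simpa using key

/-! ## (W1) The static direction is uniformly timelike outside `r = 3M` -/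

/-- **(W1)** `g_{M,a}(x)(∂_{t*}, ∂_{t*}) = −1 + 2H ≤ −1/3` whenever `0 ≤ M` and `3M ≤ r(x)`:
`H = M r³/(r⁴ + a² z²) ≤ M/r ≤ 1/3` (Visser arXiv:0706.0622, (33): `ℓ₀ = 1`). [cite: arXiv07060622, (32)–(35)] -/
theorem kerr_bilin_basisVector_zero_le (M a : ℝ) (x : E4) (hM : 0 ≤ M) (hr : 3 * M ≤ Kerr.radius a x) :
    Kerr.bilin M a x (E4.basisVector 0) (E4.basisVector 0) ≤ -(1 / 3) := by
  rw [Kerr.bilin_apply, Minkowski.bilin_basisVector_zero, Kerr.nullCovector_basisVector_zero, mul_one, mul_one]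
  suffices hH : Kerr.scalarH M a x ≤ 1 / 3 by linarith
  unfold Kerr.scalarH
  set r := Kerr.radius a x with hr_def
  have hr0 : 0 ≤ r := Kerr.radius_nonneg a x
  rcases hr0.eq_or_lt with h0 | hpos
  · have hM0 : M = 0 := le_antisymm (by linarith) hM
    rw [hM0, zero_mul, zero_div]
    norm_num
  · have hD : 0 < r ^ 4 + a ^ 2 * x 3 ^ 2 := by positivity
    rw [div_le_iff₀ hD]
    have h3 : 0 ≤ r ^ 3 := by positivity
    nlinarith [mul_le_mul_of_nonneg_right hr h3, sq_nonneg (a * x 3)]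

/-! ## (W2)–(W3) The lensing witness: the equatorial circular photon orbit -/

/-- **(W2)** The photon orbit returns to its spatial point after one revolution, shifted by `(1 − aq) 2π/q` in
`t*`: `orbitCurve a r₀ q (s + 2π/q) = orbitCurve a r₀ q s + ((1 − aq) 2π/q) ∂₀` (`q ≠ 0`). Sbierski 2015, §7A.
[cite: Sbierski2015, §7A] -/
theorem kerr_orbitCurve_add_period (a r₀ q s : ℝ) (hq : q ≠ 0) :
    Kerr.orbitCurve a r₀ q (s + 2 * Real.pi / q) =
      Kerr.orbitCurve a r₀ q s + ((1 - a * q) * (2 * Real.pi / q)) • E4.basisVector 0 := by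
  have hqs : q * (s + 2 * Real.pi / q) = q * s + 2 * Real.pi := by
    field_simp
  simp only [Kerr.orbitCurve, hqs, Real.cos_add_two_pi, Real.sin_add_two_pi, mul_add, add_smul]
  abel

/-- **(W3)** The retrograde equatorial circular photon orbit `Kerr.orbitCurve a r₀ q` (`0 < M`, `0 ≤ a ≤ M`,
`3M ≤ r₀`, `r₀ (r₀ − 3M)² = 4a²M`, `q = √(M/r₀³)`) lies in the exterior (`r₊ ≤ 2M < 3M ≤ r₀`) and, as a curve of
the exterior, is a GEODESIC of the Levi-Civita connection of `Kerr.smoothMetric M a r₊` with NULL velocity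
`Kerr.orbitVel a q` — the tree's `Kerr.exists_trappedNullGeodesic` with the curve exposed (same proof:
`OpensChart.isGeodesic_of_hasDerivAt` with `Kerr.christoffel_orbitVel`, nullity `Kerr.bilin_orbitVel_self`).
Sbierski 2015, §7A; Bardeen–Press–Teukolsky 1972, (2.18). [cite: Sbierski2015, §7A] -/
theorem kerr_orbitCurve_isGeodesic_null [Kerr.Facts] [Kerr.SliceFacts] (M a r₀ : ℝ) (hM : 0 < M) (ha0 : 0 ≤ a)
    (haM : a ≤ M) (h3M : 3 * M ≤ r₀) (hcubic : r₀ * (r₀ - 3 * M) ^ 2 = 4 * a ^ 2 * M)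
    (h : ∀ s, Kerr.orbitCurve a r₀ √(M / r₀ ^ 3) s ∈ Kerr.exterior M a) :
    Kerr.rPlus M a < r₀ ∧
    IsGeodesic (Kerr.smoothMetric M a (Kerr.rPlus M a)).leviCivita
      (fun s ↦ (⟨Kerr.orbitCurve a r₀ √(M / r₀ ^ 3) s, h s⟩ : Kerr.exterior M a)) ∧
    (∀ s, (Kerr.smoothMetric M a (Kerr.rPlus M a)).IsNull
      (velocity 𝓘(ℝ, E4) (fun s ↦ (⟨Kerr.orbitCurve a r₀ √(M / r₀ ^ 3) s, h s⟩ : Kerr.exterior M a)) s)) ∧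
    (∀ s, velocity 𝓘(ℝ, E4) (fun s ↦ (⟨Kerr.orbitCurve a r₀ √(M / r₀ ^ 3) s, h s⟩ : Kerr.exterior M a)) s =
      Kerr.orbitVel a √(M / r₀ ^ 3) (Kerr.orbitCurve a r₀ √(M / r₀ ^ 3) s)) := by
  have hr₀ : 0 < r₀ := by linarith
  set q := √(M / r₀ ^ 3) with hq_def
  have hq0 : 0 ≤ q := Real.sqrt_nonneg _
  have hq2 : q ^ 2 = M / r₀ ^ 3 := Real.sq_sqrt (by positivity)
  have hq : q ^ 2 * r₀ ^ 3 = M := by rw [hq2]; field_simp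
  have hrp : Kerr.rPlus M a < r₀ := (Kerr.rPlus_le_two_mul hM.le).trans_lt (by linarith)
  set γ : ℝ → Kerr.exterior M a := fun s ↦ ⟨Kerr.orbitCurve a r₀ q s, h s⟩ with hγ_def
  obtain ⟨hgeo, hvel⟩ := OpensChart.isGeodesic_of_hasDerivAt
    (g := (Kerr.smoothMetric M a (Kerr.rPlus M a)).toPseudoRiemannianMetric) (G := Kerr.bilin M a) (γ := γ)
    (c := Kerr.orbitCurve a r₀ q) (c' := fun s ↦ Kerr.orbitVel a q (Kerr.orbitCurve a r₀ q s))
    (c'' := fun s ↦ Kerr.orbitAcc q (Kerr.orbitCurve a r₀ q s)) (fun _ ↦ rfl)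
    (fun y ↦ Kerr.differentiableAt_bilin M a y) (fun _ ↦ rfl) Kerr.hasDerivAt_orbitCurve
    Kerr.hasDerivAt_orbitVel_orbitCurve
    (fun t ↦ Kerr.christoffel_orbitVel hr₀ hq (h t) (Kerr.orbitCurve_apply_three t)
      (Kerr.orbitCurve_circle t))
  have hvel' : ∀ s, velocity 𝓘(ℝ, E4) (M := Kerr.exterior M a) γ s =
      Kerr.orbitVel a q (Kerr.orbitCurve a r₀ q s) := hvel
  refine ⟨hrp, hgeo, fun s ↦ ⟨?_, fun h0 ↦ ?_⟩, hvel'⟩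
  · rw [hvel' s]
    exact Kerr.bilin_orbitVel_self hM ha0 h3M hq0 hq hcubic s
  · have h0' : (Kerr.orbitVel a q (Kerr.orbitCurve a r₀ q s) : E4) = (0 : E4) := (hvel' s).symm.trans h0
    have h1 := congrArg (fun v : E4 ↦ v 0) h0'
    simp only [Kerr.orbitVel_apply_zero, PiLp.zero_apply] at h1
    -- `1 - a q > 0`
    have haq : a * q < 1 := by
      have e1 : (a * q) ^ 2 * r₀ ^ 3 = a ^ 2 * M := by rw [mul_pow, mul_assoc, hq]
      have e2 : (3 * M) ^ 3 ≤ r₀ ^ 3 := pow_le_pow_left₀ (by linarith) h3M 3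
      have e3 : a ^ 2 * M ≤ M ^ 2 * M := mul_le_mul_of_nonneg_right (pow_le_pow_left₀ ha0 haM 2) hM.le
      have e4 : (a * q) ^ 2 * r₀ ^ 3 < 1 * r₀ ^ 3 := by nlinarith [pow_pos hM 3]
      have e5 : (a * q) ^ 2 < 1 := lt_of_mul_lt_mul_right e4 (pow_pos hr₀ 3).le
      nlinarith [mul_nonneg ha0 hq0]
    linarith

/-! ## The brick, assembled -/

/-- **Brick K `stub_noC0_kerrSide` — KERR–SCHILD KINEMATICS AND THE LENSING WITNESS (explicit algebra).**
(K1) the Kerr–Schild cone is narrower than the Minkowski cone of the chart, for `0 ≤ M`; (K2) the same with room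
`1/4` in operator norm: `‖v‖ ≤ 2 |v⁰|`; (K3) `t*` is a uniform time function with bounded speed along differentiable
curves causal for a `1/4`-perturbed Kerr cone field; (W1) `g_{M,a}(x)(∂₀, ∂₀) ≤ −1/3` whenever `3M ≤ r(x)`;
(W2) the photon orbit returns to its spatial point after one revolution, shifted by `(1 − aq) 2π/q` in `t*`;
(W3) the retrograde equatorial circular photon orbit is a null geodesic of `Kerr.smoothMetric M a r₊` in the
exterior with velocity `Kerr.orbitVel` (`Kerr.exists_trappedNullGeodesic` with the curve exposed).
Kerr–Schild 1965; Visser arXiv:0706.0622 (32)–(35); Bardeen–Press–Teukolsky 1972 (2.18); Sbierski 2015 §7A.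
[cite: arXiv07060622, (32)–(35)] [cite: Sbierski2015, §7A] -/
theorem stub_noC0_kerrSide :
    (∀ (M a : ℝ) (x v : E4), 0 ≤ M → Kerr.bilin M a x v v ≤ 0 → E4.spatialNorm v ^ 2 ≤ (v 0) ^ 2) ∧
    (∀ (M a : ℝ) (x v : E4) (B : E4 →L[ℝ] E4 →L[ℝ] ℝ), 0 ≤ M → ‖B - Kerr.bilin M a x‖ ≤ 1 / 4 →
      B v v ≤ 0 → ‖v‖ ≤ 2 * |v 0|) ∧
    (∀ (M a : ℝ) (B : ℝ → E4 →L[ℝ] E4 →L[ℝ] ℝ) (γ : ℝ → E4) (s₁ s₂ : ℝ), 0 ≤ M → s₁ ≤ s₂ →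
      (∀ t ∈ Set.Icc s₁ s₂, ‖B t - Kerr.bilin M a (γ t)‖ ≤ 1 / 4 ∧
        ∃ v : E4, HasDerivAt γ v t ∧ B t v v ≤ 0 ∧ 0 < v 0) →
      StrictMonoOn (fun t ↦ γ t 0) (Set.Icc s₁ s₂) ∧ ‖γ s₂ - γ s₁‖ ≤ 2 * (γ s₂ 0 - γ s₁ 0)) ∧
    (∀ (M a : ℝ) (x : E4), 0 ≤ M → 3 * M ≤ Kerr.radius a x →
      Kerr.bilin M a x (E4.basisVector 0) (E4.basisVector 0) ≤ -(1 / 3)) ∧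
    (∀ (a r₀ q s : ℝ), q ≠ 0 →
      Kerr.orbitCurve a r₀ q (s + 2 * Real.pi / q) =
        Kerr.orbitCurve a r₀ q s + ((1 - a * q) * (2 * Real.pi / q)) • E4.basisVector 0) ∧
    (∀ [Kerr.Facts] [Kerr.SliceFacts] (M a r₀ : ℝ), 0 < M → 0 ≤ a → a ≤ M → 3 * M ≤ r₀ →
      r₀ * (r₀ - 3 * M) ^ 2 = 4 * a ^ 2 * M →
      ∀ h : ∀ s, Kerr.orbitCurve a r₀ √(M / r₀ ^ 3) s ∈ Kerr.exterior M a,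
        Kerr.rPlus M a < r₀ ∧
        IsGeodesic (Kerr.smoothMetric M a (Kerr.rPlus M a)).leviCivita
          (fun s ↦ (⟨Kerr.orbitCurve a r₀ √(M / r₀ ^ 3) s, h s⟩ : Kerr.exterior M a)) ∧
        (∀ s, (Kerr.smoothMetric M a (Kerr.rPlus M a)).IsNull
          (velocity 𝓘(ℝ, E4) (fun s ↦ (⟨Kerr.orbitCurve a r₀ √(M / r₀ ^ 3) s, h s⟩ : Kerr.exterior M a)) s)) ∧
        (∀ s, velocity 𝓘(ℝ, E4) (fun s ↦ (⟨Kerr.orbitCurve a r₀ √(M / r₀ ^ 3) s, h s⟩ : Kerr.exterior M a)) s =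
          Kerr.orbitVel a √(M / r₀ ^ 3) (Kerr.orbitCurve a r₀ √(M / r₀ ^ 3) s))) :=
  ⟨kerr_spatialNorm_sq_le_time_sq, kerr_norm_le_two_mul_abs_time, kerr_time_strictMonoOn_and_norm_sub_le,
    kerr_bilin_basisVector_zero_le, kerr_orbitCurve_add_period,
    fun M a r₀ hM ha0 haM h3M hcubic h ↦ kerr_orbitCurve_isGeodesic_null M a r₀ hM ha0 haM h3M hcubic h⟩

end Summit.FinalStateConjecture.FinalStateConjecture.Theorems.PhaseMixingCaptureCaptureSufficesTame

end
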